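import Literature.Topology.FourManifolds.TrisectionsSectorOneFunction
import Literature.Topology.FourManifolds.TrisectionsSectorMorse
import Literature.Topology.FourManifolds.HCobordismTradeStep
import HarnessLib

/-!
# The handle decomposition of the straightened first sector `X₁` ("`X₁ ≅ ♮ᵏ S¹ × B³`",
# Gay–Kirby 2016, Lemma 14)

Topic `Literature/Topology/FourManifolds`; for the fact seat
`provefact-Literature.Topology.FourManifolds.exists_isBalancedGKTrisection` (Gay–Kirby 2016,
Thm. 4 via Lemma 14).  Everything in this file is **proved**; no named facts are introduced.

Gay–Kirby, proof of Lemma 14: *"`X₁` [the union of the `0`- and `1`-handles] … [is]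
diffeomorphic to `♮ᵏ S¹ × B³`"*.  For the bevelled sector `X₁ = BevelData.sector` with its
straightened structure `BevelData.cornerSliceAtlas` (corners along the central surface `F`)
this is the handle decomposition `HasHandleDecomposition 3 ↥X₁ c` with `c i` the number of
critical points of the Morse function `f` of index `i` below the level `a`
(`hasHandleDecomposition_sector`): feed the adapted function `secFun` of
`TrisectionsSectorOneFunction.lean` into `CornerSliceAtlas.hasHandleDecomposition_of_comp_val`
(`TrisectionsSectorMorse.lean`).  The items: `secFun` is smooth at the points of `X₁`; in the
corner charts along `F` it is the corner form `G ∘ cornerFold ∘ Θ` with `G(x) = 1 - x₀/(2c)`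
(`dG ≠ 0`); it is `1` at the boundary points (`F₁ = 0`) and `< 1` at the interior points
(`F₁ < 0`) of the straightened structure; it is regular at the boundary points off `F`; and its
critical points interior to `X₁` lie below the collar, where `secFun = f + (1 - a)` near each
point, so that they are exactly the critical points of `f` below `a`, nondegenerate with the same
Hessians and indices (Milnor's `Mᵃ` with the Morse data of `f|Mᵃ`, here with the corner).
With `handleCount 1 k` data for `f` below `a` (one critical point of index `0`, `k` of index
`1`: the `0`- and `1`-handles) this is the hypothesis `h₁` of `isGKTrisection_of_handles`
(`hasHandleDecomposition_sector_handleCount`).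

## References

* D. Gay, R. Kirby, *Trisecting 4-manifolds*, Geom. Topol. 20 (2016) 3097–3132
  (arXiv:1205.1565): §4, Lemma 14 and its proof. [GayKirby2016]
* J. Milnor, *Morse theory* (1963), Thm. 3.1 and §3. [Milnor1963]
-/

open scoped Manifold ContDiff Topology
open Set Function Filter

noncomputable section

universe u

namespace Literature.Topology.FourManifolds

variable {X : Type u} [TopologicalSpace X] [T2Space X] [CompactSpace X]
  [ChartedSpace (EuclideanSpace ℝ (Fin 4)) X] [IsManifold (𝓡 4) ∞ X]

namespace BiCollar

namespace BevelData

variable {B : BiCollar X} (D : B.BevelData)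

/-! ### Regular band, deep critical points, interior points (no parameters needed) -/

omit D [T2Space X] [CompactSpace X] in
/-- **The points of the band are regular for `f`** (`ξ(f) = 1` there). [cite: Milnor1963, Thm. 3.1] -/
theorem _root_.Literature.Topology.FourManifolds.BiCollar.not_isMCriticalPt_f_of_abs_le (B : BiCollar X) {x : X}
    (hx : |B.sFun x| ≤ B.U.δ) : ¬ IsMCriticalPt (𝓡 4) B.f x := by
  intro hc
  have h1 := B.U.mlineDeriv_eq_one x (by rw [B.f_eq_add_sFun]; constructor <;> linarith [(abs_le.1 hx).1, (abs_le.1 hx).2])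
  have hzero : mlineDeriv (𝓡 4) B.f x (B.U.ξ x) = 0 := by
    rw [mlineDeriv_def]
    have hc' : mfderiv (𝓡 4) 𝓘(ℝ, ℝ) B.f x = 0 := hc
    rw [hc']; rfl
  rw [hzero] at h1
  exact zero_ne_one h1

omit [T2Space X] [CompactSpace X] in
/-- **A critical point of `f` below `a` lies below the collar.** [folklore] -/
theorem sFun_lt_of_isMCriticalPt_f {x : X} (hc : IsMCriticalPt (𝓡 4) B.f x) (hxa : B.f x < B.a) :
    B.sFun x < -D.χ₁.rOut := by
  have hs : B.sFun x < 0 := by rw [sFun]; linarith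
  by_contra h
  have h' : -D.χ₁.rOut ≤ B.sFun x := not_lt.1 h
  exact B.not_isMCriticalPt_f_of_abs_le (by rw [abs_of_neg hs]; linarith [D.rOut₁_lt]) hc

/-- Below the collar (`s < -rOut₁`), `F₁ < 0`. [folklore] -/
theorem F₁_neg_of_sFun_lt {x : X} (hx : B.sFun x < -D.χ₁.rOut) : D.F₁ x < 0 := by
  have hθ : D.θ x = 0 := D.θ_eq_zero_of_le (by rw [abs_of_neg (by linarith [D.χ₁.rOut_pos])]; linarith)
  rw [F₁, hθ, mul_zero, add_zero]
  linarith [D.χ₁.rOut_pos]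

/-- **Interior points of the straightened sector are the points with `F₁ < 0`.** [folklore] -/
theorem isInteriorPoint_iff_F₁_neg (p : D.sector) :
    letI := D.cornerSliceAtlas.chartedSpace
    (𝓡∂ 4).IsInteriorPoint p ↔ D.F₁ p.1 < 0 := by
  letI := D.cornerSliceAtlas.chartedSpace
  rw [(𝓡∂ 4).isInteriorPoint_iff_not_isBoundaryPoint, D.isBoundaryPoint_iff_F₁_eq_zero]
  have hle : D.F₁ p.1 ≤ 0 := p.2
  exact ⟨fun h => lt_of_le_of_ne hle h, fun h => h.ne⟩

namespace SectorOneParams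

variable {D} (P : D.SectorOneParams)

/-! ### Below the collar `secFun = f + (1 - a)` -/

/-- **Below the collar, `secFun = f + (1 - a)` near the point.** [folklore] -/
theorem secFun_eventuallyEq_f_add {x : X} (hx : B.sFun x < -D.χ₁.rOut) :
    P.secFun =ᶠ[𝓝 x] fun y => B.f y + (1 - B.a) := by
  filter_upwards [P.secFun_eventuallyEq_of_sFun_lt hx] with y hy
  rw [hy, sFun]; ring

/-- **The critical points of `secFun` in the sector lie below the collar** (on the band part
of the sector off `F` the flow derivative is positive; the points of `F` have `s = 0` and are
in the band too). [folklore] -/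
theorem sFun_lt_of_isMCriticalPt {x : X} (hxs : x ∈ D.sector) (hxF : x ∉ B.surface)
    (hc : IsMCriticalPt (𝓡 4) P.secFun x) : B.sFun x < -D.χ₁.rOut := by
  have hs0 : B.sFun x ≤ 0 := D.sFun_nonpos_of_mem_sector hxs
  by_cases hb : |B.sFun x| < B.U.δ
  · exact absurd hc (P.not_isMCriticalPt_secFun hb hxs hxF)
  · have := not_lt.1 hb
    rw [abs_of_nonpos hs0] at this
    linarith [D.rOut₁_lt]

/-- At a critical point of `secFun` in the sector, `f` is critical too. [folklore] -/
theorem isMCriticalPt_f_of_isMCriticalPt {x : X} (hxs : x ∈ D.sector) (hxF : x ∉ B.surface)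
    (hc : IsMCriticalPt (𝓡 4) P.secFun x) : IsMCriticalPt (𝓡 4) B.f x :=
  (isMCriticalPt_congr_of_eventuallyEq_add_const (P.secFun_eventuallyEq_f_add (P.sFun_lt_of_isMCriticalPt hxs hxF hc))).1 hc

/-! ### The corner form near the central surface -/

/-- The outer function of the corner form: `G(x) = 1 - x₀ / (2c)`. [folklore] -/
def cornerG (y : EuclideanSpace ℝ (Fin 4)) : ℝ := 1 - (1 / (2 * P.c)) * y 0

omit [T2Space X] [CompactSpace X] in
/-- `G` has derivative `-(1/(2c)) • proj₀`. [folklore] -/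
theorem hasFDerivAt_cornerG (y : EuclideanSpace ℝ (Fin 4)) :
    HasFDerivAt P.cornerG (-((1 / (2 * P.c)) • (EuclideanSpace.proj (0 : Fin 4) : EuclideanSpace ℝ (Fin 4) →L[ℝ] ℝ))) y := by
  have h := ((EuclideanSpace.proj (0 : Fin 4) : EuclideanSpace ℝ (Fin 4) →L[ℝ] ℝ).hasFDerivAt (x := y)).const_mul
    (1 / (2 * P.c))
  exact h.const_sub 1

omit [T2Space X] [CompactSpace X] in
/-- `G` is smooth. [folklore] -/
theorem contDiff_cornerG : ContDiff ℝ ∞ P.cornerG :=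
  contDiff_const.sub (contDiff_const.mul
    (EuclideanSpace.proj (0 : Fin 4) : EuclideanSpace ℝ (Fin 4) →L[ℝ] ℝ).contDiff)

omit [T2Space X] [CompactSpace X] in
/-- `dG ≠ 0`. [folklore] -/
theorem fderiv_cornerG_ne_zero (y : EuclideanSpace ℝ (Fin 4)) : fderiv ℝ P.cornerG y ≠ 0 := by
  rw [(P.hasFDerivAt_cornerG y).fderiv]
  intro h
  have h1 : (-((1 / (2 * P.c)) • (EuclideanSpace.proj (0 : Fin 4) : EuclideanSpace ℝ (Fin 4) →L[ℝ] ℝ)))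
      (EuclideanSpace.single 0 1) = -(1 / (2 * P.c)) := by
    show -((1 / (2 * P.c)) * (EuclideanSpace.single (0 : Fin 4) (1 : ℝ)) 0) = _
    simp
  rw [h] at h1
  have h2 : (0 : EuclideanSpace ℝ (Fin 4) →L[ℝ] ℝ) (EuclideanSpace.single 0 1) = 0 := rfl
  rw [h2] at h1
  have hc := P.c_pos
  have : (0 : ℝ) < 1 / (2 * P.c) := by positivity
  linarith

/-- **In the corner charts along `F`, `secFun` is the corner form `G ∘ cornerFold ∘ Θ`.**
[cite: GayKirby2016, Def. 1 and Fig. 1] -/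
theorem secFun_eq_cornerG (p : D.sector) (hp : p.1 ∈ B.surface) {q : X}
    (hq : q ∈ (D.cornerSliceAtlas.cornerDatum p hp).Θ.source) :
    P.secFun q = P.cornerG (cornerFold ((D.cornerSliceAtlas.cornerDatum p hp).Θ q)) := by
  have hqb : q ∈ B.box D.εw := by
    change q ∈ B.wedgeSource (chartAt (EuclideanSpace ℝ (Fin 2)) (B.zL p.1)) D.εw at hq
    exact hq.1
  rw [P.secFun_of_mem_box hqb, cornerG, cornerFold_apply_zero,
    (D.cornerSliceAtlas.cornerDatum p hp).apply_zero q hq, (D.cornerSliceAtlas.cornerDatum p hp).apply_one q hq]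
  ring

/-! ### The handle decomposition -/

/-- **The set of interior critical points of `secFun` of index `i` is the set of critical points
of `f` of index `i` below the level `a`.** [cite: Milnor1963, Thm. 3.1 and §3] -/
theorem image_interior_inter_criticalSetOfIndex (Fr : B.MorseFrame) (i : ℕ) :
    letI := D.cornerSliceAtlas.chartedSpace
    (Subtype.val : D.sector → X) '' ((𝓡∂ 4).interior D.sector) ∩ criticalSetOfIndex (𝓡 4) P.secFun i =
      criticalSetOfIndex (𝓡 4) B.f i ∩ B.f ⁻¹' Iio B.a := by
  letI := D.cornerSliceAtlas.chartedSpace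
  have _ := Fr.isMorse
  ext x
  simp only [mem_inter_iff, mem_image, criticalSetOfIndex, mem_setOf_eq, mem_preimage, mem_Iio]
  constructor
  · rintro ⟨⟨p, hp, rfl⟩, hc, hi⟩
    have hint : (𝓡∂ 4).IsInteriorPoint p := hp
    have hF₁ : D.F₁ p.1 < 0 := (D.isInteriorPoint_iff_F₁_neg p).1 hint
    have hxF : p.1 ∉ B.surface := fun h => hF₁.ne (D.F₁_eq_zero_of_mem_surface h)
    have hs := P.sFun_lt_of_isMCriticalPt p.2 hxF hc
    have hev := P.secFun_eventuallyEq_f_add hs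
    refine ⟨⟨(isMCriticalPt_congr_of_eventuallyEq_add_const hev).1 hc, ?_⟩, ?_⟩
    · rw [← morseIndex_congr_of_eventuallyEq_add_const hev]; exact hi
    · rw [B.f_eq_add_sFun]; linarith [D.χ₁.rOut_pos]
  · rintro ⟨⟨hc, hi⟩, hxa⟩
    have hs := D.sFun_lt_of_isMCriticalPt_f hc hxa
    have hF₁ := D.F₁_neg_of_sFun_lt hs
    have hxs : x ∈ D.sector := D.mem_sector_iff.2 hF₁.le
    have hev := P.secFun_eventuallyEq_f_add hs
    refine ⟨⟨⟨x, hxs⟩, (D.isInteriorPoint_iff_F₁_neg ⟨x, hxs⟩).2 hF₁, rfl⟩,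
      (isMCriticalPt_congr_of_eventuallyEq_add_const hev).2 hc, ?_⟩
    rw [morseIndex_congr_of_eventuallyEq_add_const hev]; exact hi

include P in
/-- **The handle decomposition of the straightened first sector**: one handle of index `i` per
critical point of `f` of index `i` below the level `a` (Gay–Kirby: "`X₁` is `♮ᵏ S¹ × B³`" for
the union of the `0`- and `1`-handles; Milnor's `Mᵃ`, here with the corner along `F`).
[cite: GayKirby2016, §4, Lemma 14; Milnor1963, Thm. 3.1 and §3] -/
theorem hasHandleDecomposition_sector (Fr : B.MorseFrame) :
    letI := D.cornerSliceAtlas.chartedSpace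
    HasHandleDecomposition 3 D.sector fun i => (criticalSetOfIndex (𝓡 4) B.f i ∩ B.f ⁻¹' Iio B.a).ncard := by
  letI := D.cornerSliceAtlas.chartedSpace
  refine D.cornerSliceAtlas.hasHandleDecomposition_of_comp_val (F := P.secFun)
    (fun q hq _ => P.contMDiffAt_secFun hq) (fun p hp => ?_) (fun p hb => ?_) (fun p hb hpK => ?_)
    (fun p hi => ?_) (fun p hi hc => ?_) (fun i => by rw [P.image_interior_inter_criticalSetOfIndex Fr i])
  · -- corner form
    exact ⟨P.cornerG, P.contDiff_cornerG.contDiffAt, P.fderiv_cornerG_ne_zero _,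
      fun q hq _ => P.secFun_eq_cornerG p hp hq⟩
  · -- `= 1` on the boundary
    exact P.secFun_eq_one_of_F₁_eq_zero ((D.isBoundaryPoint_iff_F₁_eq_zero p).1 hb)
  · -- regular on the boundary off `F`
    have h0 : D.F₁ p.1 = 0 := (D.isBoundaryPoint_iff_F₁_eq_zero p).1 hb
    exact P.not_isMCriticalPt_secFun ((D.abs_sFun_lt_rIn_of_F₁_eq_zero h0).trans D.rIn₁_lt) p.2 hpK
  · -- `< 1` inside
    exact P.secFun_lt_one_of_F₁_neg ((D.isInteriorPoint_iff_F₁_neg p).1 hi)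
  · -- nondegenerate at interior critical points
    have hF₁ : D.F₁ p.1 < 0 := (D.isInteriorPoint_iff_F₁_neg p).1 hi
    have hxF : p.1 ∉ B.surface := fun h => hF₁.ne (D.F₁_eq_zero_of_mem_surface h)
    have hev := P.secFun_eventuallyEq_f_add (P.sFun_lt_of_isMCriticalPt p.2 hxF hc)
    rw [mhessian_congr_of_eventuallyEq_add_const hev]
    exact Fr.isMorse.2 _ ((isMCriticalPt_congr_of_eventuallyEq_add_const hev).1 hc)

include P in
/-- **The handle decomposition of the straightened first sector, `handleCount` form**: if `f`
has one critical point of index `0`, `k` of index `1` and none of other indices below `a`,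
then the straightened `X₁` has a handle decomposition `handleCount 1 k` — the hypothesis `h₁`
of `isGKTrisection_of_handles`. [cite: GayKirby2016, §4, Lemma 14] -/
theorem hasHandleDecomposition_sector_handleCount (Fr : B.MorseFrame) {k : ℕ}
    (hcount : ∀ i, (criticalSetOfIndex (𝓡 4) B.f i ∩ B.f ⁻¹' Iio B.a).ncard = handleCount 1 k i) :
    letI := D.cornerSliceAtlas.chartedSpace
    HasHandleDecomposition 3 D.sector (handleCount 1 k) := by
  have h := P.hasHandleDecomposition_sector Fr
  have heq : (fun i => (criticalSetOfIndex (𝓡 4) B.f i ∩ B.f ⁻¹' Iio B.a).ncard) = handleCount 1 k := funext hcount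
  rw [heq] at h
  exact h

end SectorOneParams

/-- **Existence form**: if the bevel slope is small against the slope of `χ₁`
(`κ · sup|χ₁'| · rOut₂ ≤ 1/4`), the straightened first sector has a handle decomposition with
one handle of index `i` per critical point of `f` of index `i` below `a`. [cite: GayKirby2016, §4, Lemma 14] -/
theorem hasHandleDecomposition_sector_of_small (Fr : B.MorseFrame) {L : ℝ} (hL : ∀ s, |deriv D.χ₁ s| ≤ L)
    (hκ : D.κ * L * D.χ₂.rOut ≤ 1 / 4) :
    letI := D.cornerSliceAtlas.chartedSpace
    HasHandleDecomposition 3 D.sector fun i => (criticalSetOfIndex (𝓡 4) B.f i ∩ B.f ⁻¹' Iio B.a).ncard := by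
  obtain ⟨P⟩ := D.nonempty_sectorOneParams hL hκ
  exact P.hasHandleDecomposition_sector Fr

/-! ### Bevels with small slope -/

/-- **Decreasing the bevel slope** keeps bevel data (all its constraints are monotone in `κ`). [folklore] -/
def shrinkκ (κ' : ℝ) (h0 : 0 < κ') (hle : κ' ≤ D.κ) : B.BevelData where
  χ₁ := D.χ₁
  χ₂ := D.χ₂
  κ := κ'
  κ_pos := h0
  κ_le_one := hle.trans D.κ_le_one
  rOut₁_lt := D.rOut₁_lt
  rOut₂_lt := D.rOut₂_lt
  κ_mul_rOut₂_lt := (mul_le_mul_of_nonneg_right hle D.χ₂.rOut_pos.le).trans_lt D.κ_mul_rOut₂_lt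

omit [T2Space X] [CompactSpace X] in
/-- The bumps of `shrinkκ` are unchanged. [folklore] -/
@[simp] theorem shrinkκ_χ₁ (κ' : ℝ) (h0 : 0 < κ') (hle : κ' ≤ D.κ) : (D.shrinkκ κ' h0 hle).χ₁ = D.χ₁ := rfl

omit [T2Space X] [CompactSpace X] in
/-- The bumps of `shrinkκ` are unchanged. [folklore] -/
@[simp] theorem shrinkκ_χ₂ (κ' : ℝ) (h0 : 0 < κ') (hle : κ' ≤ D.κ) : (D.shrinkκ κ' h0 hle).χ₂ = D.χ₂ := rfl

omit [T2Space X] [CompactSpace X] in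
/-- The slope of `shrinkκ`. [folklore] -/
@[simp] theorem shrinkκ_κ (κ' : ℝ) (h0 : 0 < κ') (hle : κ' ≤ D.κ) : (D.shrinkκ κ' h0 hle).κ = κ' := rfl

omit D [T2Space X] [CompactSpace X] in
/-- **Bevel data with small slope exist**: `κ · sup|χ₁'| · rOut₂ ≤ 1/4`. [folklore] -/
theorem _root_.Literature.Topology.FourManifolds.BiCollar.exists_bevelData_small (B : BiCollar X) :
    ∃ (D : B.BevelData) (L : ℝ), (∀ s, |deriv D.χ₁ s| ≤ L) ∧ D.κ * L * D.χ₂.rOut ≤ 1 / 4 := by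
  obtain ⟨D₀⟩ := B.nonempty_bevelData
  obtain ⟨L, hL0, hL⟩ := D₀.χ₁.exists_abs_deriv_le
  have hr := D₀.χ₂.rOut_pos
  have hden : 0 < 4 * (L * D₀.χ₂.rOut + 1) := by positivity
  set κ' : ℝ := min D₀.κ (1 / (4 * (L * D₀.χ₂.rOut + 1))) with hκ'
  have h0 : 0 < κ' := lt_min D₀.κ_pos (by positivity)
  have hle : κ' ≤ D₀.κ := min_le_left _ _
  refine ⟨D₀.shrinkκ κ' h0 hle, L, hL, ?_⟩
  show κ' * L * D₀.χ₂.rOut ≤ 1 / 4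
  have h1 : κ' ≤ 1 / (4 * (L * D₀.χ₂.rOut + 1)) := min_le_right _ _
  have h2 : 0 ≤ L * D₀.χ₂.rOut := by positivity
  calc κ' * L * D₀.χ₂.rOut = κ' * (L * D₀.χ₂.rOut) := by ring
    _ ≤ 1 / (4 * (L * D₀.χ₂.rOut + 1)) * (L * D₀.χ₂.rOut) := mul_le_mul_of_nonneg_right h1 h2
    _ ≤ 1 / 4 := by
        rw [div_mul_eq_mul_div, one_mul, div_le_div_iff₀ hden (by norm_num : (0:ℝ) < 4)]
        nlinarith

/-- **The straightened first sector of a small-slope bevel has a handle decomposition with one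
handle per critical point of `f` below `a`** (existence over the bevel). [cite: GayKirby2016, §4, Lemma 14] -/
theorem _root_.Literature.Topology.FourManifolds.BiCollar.exists_bevelData_hasHandleDecomposition (B : BiCollar X)
    (Fr : B.MorseFrame) :
    ∃ D : B.BevelData, letI := D.cornerSliceAtlas.chartedSpace
      HasHandleDecomposition 3 D.sector fun i => (criticalSetOfIndex (𝓡 4) B.f i ∩ B.f ⁻¹' Iio B.a).ncard := by
  obtain ⟨D, L, hL, hκ⟩ := B.exists_bevelData_small
  exact ⟨D, D.hasHandleDecomposition_sector_of_small Fr hL hκ⟩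

end BevelData

end BiCollar

end Literature.Topology.FourManifolds

end
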